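import Literature.Analysis.FluidPDE.LocalTypeIReverseZoom
import HarnessLib

/-!
# Slab profiles with `𝐈 < ∞` and a singular origin are local Type I singular points (Albritton–Barker 2019)

Analysis/FluidPDE proofs-layer file (theorems only; no definitions, no named facts, no `sorry`) over
`Literature/Analysis/FluidPDE/LocalTypeI.lean` (D. Albritton, T. Barker, *On local Type I
singularities of the Navier–Stokes equations and Liouville theorems*, J. Math. Fluid Mech. 21
(2019), no. 3 = arXiv:1811.00502, §1: Thm 1.1, the displays defining `A, C, D, E, 𝐈(ω)`, singular
and Type I points; Def. 2.1).

A–B §1 define a Type I singular point `z` of a suitable weak solution `(v, q)` living on a region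
`ω` by "there exists a parabolic ball `Q'` centered at the singular point `z` and `𝐈(Q') < ∞`".  The
Type-I profile classes used by the summit routes (RellichScar, RecurrentProfiles, TypeILiouville,
…) are suitable weak solutions on the whole backward slab `ω = ℝ³ × ℝ₋` with `𝐈(ℝ³ × ℝ₋) < ∞` and a
backward-singular origin.  This file supplies the bookkeeping that such a slab profile IS a local
Type I singular point in the printed sense (`IsLocalTypeISingularPoint`, which asks in addition for
A–B Def. 2.1's global classes on the ball, in particular `q ∈ L^{3/2}(Q')`): the only work is the
pressure, which on the slab is determined up to a function of time and need not be `L^{3/2}` up to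
the final time; normalising it to mean zero on `B(0,1)` (a function of time in `L^{3/2}_loc` of the
open ball, invisible to the equations, the local energy inequality and the mean-free `D`) puts it in
`L^{3/2}(Q(0,1))` with norm `≤ 𝐈^{2/3}`.

* `ae_integrableOn_slice_of_locallyIntegrableOn_slab` — slices of an `L¹_loc(slab)` pressure are
  integrable on balls for a.e. time below a top time `t₀ ≤ 0` (hypothesis of `cknDOsc_sub_fun_time`
  for balls touching the final time);
* `memLp_mean_of_compact` — the `B(0,1)`-means of the slab pressure are `L^{3/2}` on compacts of
  `Q(0,1)`;
* `isLocalTypeISingularPoint_of_slabProfile` — the packaging theorem;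
* `localTypeISingularityExists_of_slabProfile` — hence such a profile witnesses the registered OPEN
  statement `LocalTypeISingularityExists` (A–B Thm 1.1, first bullet).

Used by the disprover of route item `SymmetricScarExists` (stmt-NavierStokesRegularity-11718, route
RellichScar): every item of that route quantifying over a singular slab profile is a corollary of
`¬ LocalTypeISingularityExists`, and a refutation of any of them proves that open bullet.

## References

* D. Albritton, T. Barker, J. Math. Fluid Mech. 21 (2019), no. 43 = arXiv:1811.00502, §1 (Thm 1.1;
  `A, C, D, E, 𝐈`; singular and Type I points), Def. 2.1, §3. [AlbrittonBarker2019]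
* G. Koch, N. Nadirashvili, G. Seregin, V. Šverák, Acta Math. 203 (2009) 83–105, §1 (the pressure of
  an ancient solution is determined up to a function of time; conjecture (L)). [KNSS2009]
-/

noncomputable section

open MeasureTheory Set Function Filter Topology TopologicalSpace Metric
open scoped NNReal ENNReal

namespace Literature.Analysis.FluidPDE

section SlabProfile

variable {u : ℝ → (EuclideanSpace ℝ (Fin 3)) → (EuclideanSpace ℝ (Fin 3))} {p : ℝ → (EuclideanSpace ℝ (Fin 3)) → ℝ} {G : ℝ → (EuclideanSpace ℝ (Fin 3)) → (EuclideanSpace ℝ (Fin 3)) →L[ℝ] (EuclideanSpace ℝ (Fin 3))}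

/-- Parabolic balls with top time `t ≤ 0` lie in the backward slab. [folklore] -/
theorem parabolicCylinder_subset_slab (r : ℝ) {z : ℝ × (EuclideanSpace ℝ (Fin 3))} (hz : z.1 ≤ 0) :
    parabolicCylinder r z ⊆ (((slab (EuclideanSpace ℝ (Fin 3)) (Iio (0 : ℝ)) isOpen_Iio) : Opens (ℝ × (EuclideanSpace ℝ (Fin 3)))) : Set (ℝ × (EuclideanSpace ℝ (Fin 3)))) := by
  intro w hw
  rw [mem_parabolicCylinder] at hw
  rw [coe_slab]
  exact ⟨lt_of_lt_of_le hw.1.2 hz, mem_univ _⟩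

/-- `Opens` form of `parabolicCylinder_subset_slab`. [folklore] -/
theorem parabolicCylinderOpens_le_slab (r : ℝ) {z : ℝ × (EuclideanSpace ℝ (Fin 3))} (hz : z.1 ≤ 0) :
    parabolicCylinderOpens r z ≤ ((slab (EuclideanSpace ℝ (Fin 3)) (Iio (0 : ℝ)) isOpen_Iio) : Opens (ℝ × (EuclideanSpace ℝ (Fin 3)))) :=
  fun _ hw => parabolicCylinder_subset_slab r hz hw

/-- **Slices of the slab pressure are integrable on balls, a.e. in time.** If `p` is locally
integrable on the open slab and `t₀ ≤ 0`, then for a.e. `t ∈ (t₀ - r², t₀)` the slice `p(t, ·)` is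
integrable on `B(x₀, r)` (Fubini on the compact blocks `[t₀ - r², t₀ - 1/(n+1)] × B̄(x₀, r)` of the
slab, which exhaust the time interval).  This is the hypothesis of `cknDOsc_sub_fun_time` for balls
touching the final time. [folklore] -/
theorem ae_integrableOn_slice_of_locallyIntegrableOn_slab
    (hp : LocallyIntegrableOn (uncurry p) (((slab (EuclideanSpace ℝ (Fin 3)) (Iio (0 : ℝ)) isOpen_Iio) : Opens (ℝ × (EuclideanSpace ℝ (Fin 3)))) : Set (ℝ × (EuclideanSpace ℝ (Fin 3)))) volume)
    {r : ℝ} {z : ℝ × (EuclideanSpace ℝ (Fin 3))} (hz : z.1 ≤ 0) :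
    ∀ᵐ t ∂(volume.restrict (Ioo (z.1 - r ^ 2) z.1)), IntegrableOn (p t) (ball z.2 r) volume := by
  set I : ℕ → Set ℝ := fun n => Icc (z.1 - r ^ 2) (z.1 - 1 / ((n : ℝ) + 1)) with hI
  have hcover : Ioo (z.1 - r ^ 2) z.1 ⊆ ⋃ n, I n := by
    intro t ht
    obtain ⟨n, hn⟩ := exists_nat_one_div_lt (sub_pos.2 ht.2)
    exact mem_iUnion.2 ⟨n, ht.1.le, by linarith⟩
  refine ae_restrict_of_ae_restrict_of_subset hcover ?_
  rw [ae_restrict_iUnion_iff]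
  intro n
  have hK : IsCompact (I n ×ˢ closedBall z.2 r) := isCompact_Icc.prod (isCompact_closedBall _ _)
  have hKsub : I n ×ˢ closedBall z.2 r ⊆ (((slab (EuclideanSpace ℝ (Fin 3)) (Iio (0 : ℝ)) isOpen_Iio) : Opens (ℝ × (EuclideanSpace ℝ (Fin 3)))) : Set (ℝ × (EuclideanSpace ℝ (Fin 3)))) := by
    rintro ⟨t, x⟩ ⟨ht, -⟩
    rw [coe_slab]
    refine ⟨?_, mem_univ _⟩
    have h1 : 0 < 1 / ((n : ℝ) + 1) := by positivity
    show t < 0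
    linarith [ht.2]
  have hint : IntegrableOn (uncurry p) (I n ×ˢ closedBall z.2 r) volume :=
    hp.integrableOn_compact_subset hKsub hK
  rw [IntegrableOn, volume_restrict_prod_eq] at hint
  filter_upwards [hint.prod_right_ae] with t ht
  have ht' : IntegrableOn (p t) (closedBall z.2 r) volume := ht
  exact ht'.mono_set ball_subset_closedBall

/-- **The ball means of the slab pressure are locally `L^{3/2}` in the unit parabolic ball.**
For a compact `K ⊆ Q(0, 1)`, with `T = fst '' K` (a compact subset of `(-1, 0)`): the mean
`t ↦ ⨍_{B(0,1)} p(t, y) dy`, as a space–time function, is in `L^{3/2}(T × B(0,1))`, and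
`K ⊆ T × B(0,1)` (the pressure class of the slab on the compact `T × B̄(0,1)` plus
`memLp_setAverage_slice`). [folklore] -/
theorem memLp_mean_of_compact (hsw : IsSuitableWeakSolutionOn (slab (EuclideanSpace ℝ (Fin 3)) (Iio (0 : ℝ)) isOpen_Iio) 1 0 u p) {K : Set (ℝ × (EuclideanSpace ℝ (Fin 3)))}
    (hK : IsCompact K) (hKQ : K ⊆ parabolicCylinder 1 (0 : ℝ × (EuclideanSpace ℝ (Fin 3)))) :
    MemLp (fun w : ℝ × (EuclideanSpace ℝ (Fin 3)) => ⨍ y in ball (0 : (EuclideanSpace ℝ (Fin 3))) 1, p w.1 y) (3 / 2)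
        (volume.restrict ((Prod.fst '' K) ×ˢ ball (0 : (EuclideanSpace ℝ (Fin 3))) 1)) ∧
      K ⊆ (Prod.fst '' K) ×ˢ ball (0 : (EuclideanSpace ℝ (Fin 3))) 1 := by
  obtain ⟨h32, h32', h32r⟩ := threeHalves_facts
  set T : Set ℝ := Prod.fst '' K with hT
  have hTc : IsCompact T := hK.image continuous_fst
  have hKT : K ⊆ T ×ˢ ball (0 : (EuclideanSpace ℝ (Fin 3))) 1 := by
    intro w hw
    refine ⟨mem_image_of_mem _ hw, ?_⟩
    have h := hKQ hw
    rw [mem_parabolicCylinder] at h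
    rw [mem_ball]
    simpa using h.2
  have hK' : IsCompact (T ×ˢ closedBall (0 : (EuclideanSpace ℝ (Fin 3))) 1) := hTc.prod (isCompact_closedBall _ _)
  have hK'sub : T ×ˢ closedBall (0 : (EuclideanSpace ℝ (Fin 3))) 1 ⊆ (((slab (EuclideanSpace ℝ (Fin 3)) (Iio (0 : ℝ)) isOpen_Iio) : Opens (ℝ × (EuclideanSpace ℝ (Fin 3)))) : Set (ℝ × (EuclideanSpace ℝ (Fin 3)))) := by
    rintro ⟨t, x⟩ ⟨ht, -⟩
    obtain ⟨w, hw, hwt⟩ := ht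
    have h := hKQ hw
    rw [mem_parabolicCylinder] at h
    rw [coe_slab]
    refine ⟨?_, mem_univ _⟩
    have hwt' : w.1 = t := hwt
    show t < 0
    rw [← hwt']
    simpa using h.1.2
  have hfin := hsw.pressure _ hK'sub hK'
  have hsub : T ×ˢ ball (0 : (EuclideanSpace ℝ (Fin 3))) 1 ⊆ T ×ˢ closedBall (0 : (EuclideanSpace ℝ (Fin 3))) 1 :=
    prod_mono Subset.rfl ball_subset_closedBall
  have hpm : MemLp (uncurry p) (3 / 2) (volume.restrict (T ×ˢ ball (0 : (EuclideanSpace ℝ (Fin 3))) 1)) := by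
    have hli : LocallyIntegrableOn (uncurry p) _ volume := hsw.distributional.2.2.1
    refine ⟨hli.aestronglyMeasurable.mono_measure
      (Measure.restrict_mono (hsub.trans hK'sub) le_rfl), ?_⟩
    rw [eLpNorm_eq_lintegral_rpow_enorm_toReal (zero_lt_one.trans_le h32).ne' h32', h32r]
    refine ENNReal.rpow_lt_top_of_nonneg (by positivity) ?_
    exact (lt_of_le_of_lt (lintegral_mono_set hsub) hfin).ne
  exact ⟨memLp_setAverage_slice (measure_ball_pos volume _ one_pos).ne' measure_ball_lt_top.ne
    h32 h32' hpm, hKT⟩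

/-- **Packaging theorem.**  Let `(u, p)` be a suitable weak solution of Navier–Stokes
(`ν = 1`, `f = 0`) on the slab `(EuclideanSpace ℝ (Fin 3)) × (−∞, 0)` with weak spatial gradient `G`, Albritton–Barker
quantity `𝐈((EuclideanSpace ℝ (Fin 3)) × ℝ₋) < ∞` and a backward-singular origin.  Then, with the pressure normalised to
mean zero on `B(0, 1)` at each time (a function of time, invisible to the equations, to the local
energy inequality and to the mean-free `D`), the origin is a local Type I singular point in the
printed sense of Albritton–Barker 2019, Thm 1.1 / Def. 2.1, in the unit parabolic ball:
`IsLocalTypeISingularPoint 1 0 u (p − [p]_{B(0,1)})`.  Ingredients: restriction of suitable weak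
solutions (`of_le`), subtraction of an `L^{3/2}_loc` function of time from the pressure
(`sub_pressure`, fed by `memLp_mean_of_compact`), `A(Q(0,1)) + E(Q(0,1)) ≤ 𝐈` for the global
classes, `‖p − [p]‖_{L^{3/2}(Q(0,1))} ≤ 𝐈^{2/3}` (`eLpNorm_zoom_pressure_le` at scale `1`), and
`D(Q(z,r); p − [p]_{B(0,1)}) = D(Q(z,r); p)` on every sub-ball (`cknDOsc_sub_fun_time` with
`ae_integrableOn_slice_of_locallyIntegrableOn_slab`).  No Type-I decay of `u` is assumed.
[cite: AlbrittonBarker2019, §1 and Def. 2.1] -/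
theorem isLocalTypeISingularPoint_of_slabProfile
    (hsw : IsSuitableWeakSolutionOn (slab (EuclideanSpace ℝ (Fin 3)) (Iio (0 : ℝ)) isOpen_Iio) 1 0 u p) (hwg : HasWeakSpatialGradientOn (slab (EuclideanSpace ℝ (Fin 3)) (Iio (0 : ℝ)) isOpen_Iio) u G)
    (hI : typeIBound (Iio (0 : ℝ) ×ˢ (univ : Set (EuclideanSpace ℝ (Fin 3)))) u p G < ⊤)
    (hsing : IsBackwardSingularPoint u 0) :
    IsLocalTypeISingularPoint 1 0 u (fun t x => p t x - ⨍ y in ball (0 : (EuclideanSpace ℝ (Fin 3))) 1, p t y) := by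
  obtain ⟨h32, h32', h32r⟩ := threeHalves_facts
  set I := typeIBound (Iio (0 : ℝ) ×ˢ (univ : Set (EuclideanSpace ℝ (Fin 3)))) u p G with hIdef
  have hItop : I ≠ ⊤ := hI.ne
  have hle : parabolicCylinderOpens 1 (0 : ℝ × (EuclideanSpace ℝ (Fin 3))) ≤ ((slab (EuclideanSpace ℝ (Fin 3)) (Iio (0 : ℝ)) isOpen_Iio) : Opens (ℝ × (EuclideanSpace ℝ (Fin 3)))) :=
    parabolicCylinderOpens_le_slab 1 le_rfl
  have hsub : parabolicCylinder 1 (0 : ℝ × (EuclideanSpace ℝ (Fin 3))) ⊆ Iio (0 : ℝ) ×ˢ (univ : Set (EuclideanSpace ℝ (Fin 3))) :=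
    parabolicCylinder_subset_lowerHalf le_rfl 1
  have hswQ := hsw.of_le hle
  have hwgQ := hwg.mono hle
  have hbound : abScaledSum 1 0 u p G ≤ I := abScaledSum_le_typeIBound one_pos hsub
  -- the ball means of the pressure, as a function of time
  set c : ℝ → ℝ := fun t => ⨍ y in ball (0 : (EuclideanSpace ℝ (Fin 3))) 1, p t y with hc
  have hcK : ∀ K ⊆ ((parabolicCylinderOpens 1 (0 : ℝ × (EuclideanSpace ℝ (Fin 3))) : Opens (ℝ × (EuclideanSpace ℝ (Fin 3)))) : Set (ℝ × (EuclideanSpace ℝ (Fin 3)))),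
      IsCompact K → IntegrableOn (fun z : ℝ × (EuclideanSpace ℝ (Fin 3)) => c z.1) K volume ∧
        ∫⁻ z in K, ‖c z.1‖ₑ ^ (3 / 2 : ℝ) < ∞ := by
    intro K hKQ hK
    obtain ⟨hmean, hKT⟩ := memLp_mean_of_compact hsw hK hKQ
    haveI : IsFiniteMeasure (volume.restrict ((Prod.fst '' K) ×ˢ ball (0 : (EuclideanSpace ℝ (Fin 3))) 1)) := by
      refine ⟨?_⟩
      rw [Measure.restrict_apply_univ]
      exact lt_of_le_of_lt (measure_mono (prod_mono Subset.rfl ball_subset_closedBall))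
        ((hK.image continuous_fst).prod (isCompact_closedBall (0 : (EuclideanSpace ℝ (Fin 3))) 1)).measure_lt_top
    have h1 : IntegrableOn (fun z : ℝ × (EuclideanSpace ℝ (Fin 3)) => c z.1) ((Prod.fst '' K) ×ˢ ball (0 : (EuclideanSpace ℝ (Fin 3))) 1) volume :=
      hmean.integrable h32
    refine ⟨h1.mono_set hKT, ?_⟩
    have hfin := hmean.eLpNorm_lt_top
    rw [eLpNorm_eq_lintegral_rpow_enorm_toReal (zero_lt_one.trans_le h32).ne' h32', h32r] at hfin
    exact lt_of_le_of_lt (lintegral_mono_set hKT)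
      ((ENNReal.rpow_lt_top_iff_of_pos (by norm_num)).1 hfin)
  have hcli : LocallyIntegrableOn (fun z : ℝ × (EuclideanSpace ℝ (Fin 3)) => c z.1)
      ((parabolicCylinderOpens 1 (0 : ℝ × (EuclideanSpace ℝ (Fin 3))) : Opens (ℝ × (EuclideanSpace ℝ (Fin 3)))) : Set (ℝ × (EuclideanSpace ℝ (Fin 3)))) volume :=
    (locallyIntegrableOn_iff (isOpen_parabolicCylinder (1 : ℝ) (0 : ℝ × (EuclideanSpace ℝ (Fin 3)))).isLocallyClosed).2
      fun K hKQ hK => (hcK K hKQ hK).1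
  have hswQ' : IsSuitableWeakSolutionOn (parabolicCylinderOpens 1 (0 : ℝ × (EuclideanSpace ℝ (Fin 3)))) 1 0 u
      (fun t x => p t x - c t) :=
    hswQ.sub_pressure hcli fun K hKQ hK => (hcK K hKQ hK).2
  -- the normalised pressure is in `L^{3/2}` of the whole ball, by `D(Q(0,1)) ≤ 𝐈`
  have hp' : MemLp (uncurry fun t x => p t x - c t) (3 / 2)
      (volume.restrict (parabolicCylinder 1 (0 : ℝ × (EuclideanSpace ℝ (Fin 3))))) := by
    have e : ((1 : ℝ) ^ 2 • stPull ((1 : ℝ) ^ 2) 1 0 0 p) = p := by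
      funext t x
      simp [stPull]
    have h := eLpNorm_zoom_pressure_le (p₀ := p) (c := 1) (t₁ := 0) one_pos le_rfl (0 : (EuclideanSpace ℝ (Fin 3))) u G
    rw [e] at h
    refine ⟨?_, lt_of_le_of_lt h (ENNReal.rpow_lt_top_of_nonneg (by norm_num) hItop)⟩
    have e2 : uncurry (fun t x => p t x - c t) = uncurry p - fun z : ℝ × (EuclideanSpace ℝ (Fin 3)) => c z.1 := rfl
    rw [e2]
    exact (hsw.distributional.2.2.1.aestronglyMeasurable.mono_measure
      (Measure.restrict_mono (parabolicCylinder_subset_slab 1 le_rfl) le_rfl)).sub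
      hcli.aestronglyMeasurable
  refine ⟨one_pos, ⟨hswQ', ?_, ⟨G, hwgQ, ?_⟩, hp'⟩, hsing, G, hwgQ, ?_⟩
  · -- `A(Q(0,1)) ≤ 𝐈`: the global energy class on the ball
    refine ⟨I.toNNReal, ?_⟩
    have hA := cknAEss_le_abScaledSum.trans hbound
    unfold cknAEss at hA
    simp only [ENNReal.ofReal_one, inv_one, one_mul] at hA
    filter_upwards [ENNReal.ae_le_essSup fun t : ℝ =>
      ∫⁻ x in ball (0 : ℝ × (EuclideanSpace ℝ (Fin 3))).2 1, ‖u t x‖ₑ ^ 2] with t ht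
    rw [ENNReal.coe_toNNReal hItop]
    exact ht.trans hA
  · -- `E(Q(0,1)) ≤ 𝐈`: the gradient is square integrable on the ball
    have hE := cknE_le_abScaledSum.trans hbound
    unfold cknE at hE
    rw [ENNReal.ofReal_one, inv_one, one_mul] at hE
    exact lt_of_le_of_lt hE hI
  · -- `𝐈(Q(0,1); u, p - [p], G) ≤ 𝐈(u, p, G)`: `D` does not see the subtracted function of time
    refine lt_of_le_of_lt (typeIBound_le_iff.2 fun r hr z hz => ?_) hI
    have hz0 : z.1 ≤ 0 := fst_nonpos_of_parabolicCylinder_subset hr hz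
    have hD : cknDOsc r z (fun t x => p t x - c t) = cknDOsc r z p :=
      cknDOsc_sub_fun_time hr c
        (ae_integrableOn_slice_of_locallyIntegrableOn_slab hsw.distributional.2.2.1 hz0)
    have hS : abScaledSum r z u (fun t x => p t x - c t) G = abScaledSum r z u p G := by
      unfold abScaledSum
      rw [hD]
    rw [hS]
    exact abScaledSum_le_typeIBound hr (hz.trans hsub)

/-- **Slab profiles witness `LocalTypeISingularityExists`.**  Any suitable weak solution on
`(EuclideanSpace ℝ (Fin 3)) × (−∞, 0)` with a weak gradient, `𝐈 < ∞` and a singular origin is a witness of the tree's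
registered OPEN statement `LocalTypeISingularityExists` (Albritton–Barker 2019, Thm 1.1, first
bullet: "there exists a suitable weak solution with Type I singular point" — expected to be FALSE
under the Liouville conjecture (L) of KNSS 2009, A–B §1). [cite: AlbrittonBarker2019, Thm 1.1] -/
theorem localTypeISingularityExists_of_slabProfile
    (hsw : IsSuitableWeakSolutionOn (slab (EuclideanSpace ℝ (Fin 3)) (Iio (0 : ℝ)) isOpen_Iio) 1 0 u p) (hwg : HasWeakSpatialGradientOn (slab (EuclideanSpace ℝ (Fin 3)) (Iio (0 : ℝ)) isOpen_Iio) u G)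
    (hI : typeIBound (Iio (0 : ℝ) ×ˢ (univ : Set (EuclideanSpace ℝ (Fin 3)))) u p G < ⊤)
    (hsing : IsBackwardSingularPoint u 0) : LocalTypeISingularityExists :=
  ⟨1, 0, u, _, isLocalTypeISingularPoint_of_slabProfile hsw hwg hI hsing⟩

end SlabProfile

end Literature.Analysis.FluidPDE
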